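import Summits.CriticalPhenomena.PercolationContinuityZ3.Theorems.PercNearOneGluingNoHeavyLowerTailSahiHittingMissLogSupermodular
import HarnessLib

/-!
# `NoHeavyLowerTail` (stmt-CriticalPhenomena-4575) — the third interval-Möbius inequality of the miss probabilities of a hitting family ("FM3" atom)

Support file, seat `prim-l12-p5` (gen 9), `--supports stmt-CriticalPhenomena-4575`.  Standard axioms, no definitions, no sorries.
With `W(R) = ∏_{c ∈ ⋃_{x∈R} A_x} q_c` (probability that no `A_x`, `x ∈ R`, is hit; `q_c = 1 − p_c ∈ [0,1]`), for every `D ⊆ {0,…,k−1}` and slots `i, j, l`: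
  `W(D+i)·W(D+j)·W(D+l)·W(D+i+j+l) ≤ W(D)·W(D+i+j)·W(D+i+l)·W(D+j+l)`   (`prod_biUnion_fm3`, event form `miss_mobius_three`),
where `D+i = insert i D`.  Proof: with `a = A_i, b = A_j, e = A_l, d = ⋃_D A` and `∏_{S∪T}∏_{S∩T} = ∏_S∏_T` three times, both sides share the factor
`W(a∪b∪d)·W(a∪b∪e∪d)·W((a∩b)∪e∪d)`, and the remaining factors are `∏_{(a∩b∩e)∪d} q ≤ ∏_d q` (the extra coins touch all three of `i,j,l` and avoid `D`; `q ≤ 1`).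
In containment-function terms (`F(S) = W(Sᶜ)`) this is the |S| = 3 interval-Möbius inequality
`F(R∪S)F(R∪i)F(R∪j)F(R∪k) ≥ F(R∪ij)F(R∪ik)F(R∪jk)F(R)` of the census lane (ttrl2 cp-coin, run/shared/lean/ttrl/coin/COIN.md §3.3), the "FM3" atom of its coin-step
certificates; |S| = 2 is `prod_biUnion_mul_le`. [this work; folklore]
-/

namespace Summit.CriticalPhenomena.PercolationContinuityZ3.Theorems

namespace SahiHitting

open Finset MeasureTheory Literature.Probability.LatticeModels

variable {ι : Type*} [DecidableEq ι]

/-- **FM3** (product form): `W(D+i)W(D+j)W(D+l)W(D+i+j+l) ≤ W(D)W(D+i+j)W(D+i+l)W(D+j+l)` for `q ∈ [0,1]^ι`. [this work; folklore] -/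
theorem prod_biUnion_fm3 {k : ℕ} (A : Fin k → Finset ι) (q : ι → ℝ) (hq0 : ∀ c, 0 ≤ q c) (hq1 : ∀ c, q c ≤ 1)
    (D : Finset (Fin k)) (i j l : Fin k) :
    (∏ c ∈ (insert i D).biUnion A, q c) * (∏ c ∈ (insert j D).biUnion A, q c) * (∏ c ∈ (insert l D).biUnion A, q c)
        * (∏ c ∈ (insert i (insert j (insert l D))).biUnion A, q c)
      ≤ (∏ c ∈ D.biUnion A, q c) * (∏ c ∈ (insert i (insert j D)).biUnion A, q c)
        * (∏ c ∈ (insert i (insert l D)).biUnion A, q c) * (∏ c ∈ (insert j (insert l D)).biUnion A, q c) := by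
  simp only [Finset.biUnion_insert]
  set a := A i
  set b := A j
  set e := A l
  set d := D.biUnion A
  have key : ∀ s t : Finset ι, (∏ c ∈ s, q c) * (∏ c ∈ t, q c) = (∏ c ∈ s ∪ t, q c) * (∏ c ∈ s ∩ t, q c) :=
    fun s t => (Finset.prod_union_inter).symm
  have S1 : (a ∪ d) ∪ (b ∪ d) = a ∪ (b ∪ d) := by ext x; simp only [mem_union]; tauto
  have S2 : (a ∪ d) ∩ (b ∪ d) = (a ∩ b) ∪ d := by ext x; simp only [mem_union, mem_inter]; tauto
  have S3 : ((a ∩ b) ∪ d) ∪ (e ∪ d) = (a ∩ b) ∪ (e ∪ d) := by ext x; simp only [mem_union, mem_inter]; tauto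
  have S4 : ((a ∩ b) ∪ d) ∩ (e ∪ d) = (a ∩ b ∩ e) ∪ d := by ext x; simp only [mem_union, mem_inter]; tauto
  have S5 : (a ∪ (e ∪ d)) ∪ (b ∪ (e ∪ d)) = a ∪ (b ∪ (e ∪ d)) := by ext x; simp only [mem_union]; tauto
  have S6 : (a ∪ (e ∪ d)) ∩ (b ∪ (e ∪ d)) = (a ∩ b) ∪ (e ∪ d) := by ext x; simp only [mem_union, mem_inter]; tauto
  have e1 : (∏ c ∈ a ∪ d, q c) * (∏ c ∈ b ∪ d, q c) = (∏ c ∈ a ∪ (b ∪ d), q c) * (∏ c ∈ (a ∩ b) ∪ d, q c) := by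
    rw [key, S1, S2]
  have e2 : (∏ c ∈ (a ∩ b) ∪ d, q c) * (∏ c ∈ e ∪ d, q c) = (∏ c ∈ (a ∩ b) ∪ (e ∪ d), q c) * (∏ c ∈ (a ∩ b ∩ e) ∪ d, q c) := by
    rw [key, S3, S4]
  have e3 : (∏ c ∈ a ∪ (e ∪ d), q c) * (∏ c ∈ b ∪ (e ∪ d), q c)
      = (∏ c ∈ a ∪ (b ∪ (e ∪ d)), q c) * (∏ c ∈ (a ∩ b) ∪ (e ∪ d), q c) := by
    rw [key, S5, S6]
  have L : (∏ c ∈ a ∪ d, q c) * (∏ c ∈ b ∪ d, q c) * (∏ c ∈ e ∪ d, q c) * (∏ c ∈ a ∪ (b ∪ (e ∪ d)), q c)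
      = ((∏ c ∈ a ∪ (b ∪ d), q c) * (∏ c ∈ a ∪ (b ∪ (e ∪ d)), q c) * (∏ c ∈ (a ∩ b) ∪ (e ∪ d), q c))
          * (∏ c ∈ (a ∩ b ∩ e) ∪ d, q c) := by
    linear_combination ((∏ c ∈ e ∪ d, q c) * (∏ c ∈ a ∪ (b ∪ (e ∪ d)), q c)) * e1
      + ((∏ c ∈ a ∪ (b ∪ d), q c) * (∏ c ∈ a ∪ (b ∪ (e ∪ d)), q c)) * e2
  have R : (∏ c ∈ d, q c) * (∏ c ∈ a ∪ (b ∪ d), q c) * (∏ c ∈ a ∪ (e ∪ d), q c) * (∏ c ∈ b ∪ (e ∪ d), q c)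
      = ((∏ c ∈ a ∪ (b ∪ d), q c) * (∏ c ∈ a ∪ (b ∪ (e ∪ d)), q c) * (∏ c ∈ (a ∩ b) ∪ (e ∪ d), q c))
          * (∏ c ∈ d, q c) := by
    linear_combination ((∏ c ∈ d, q c) * (∏ c ∈ a ∪ (b ∪ d), q c)) * e3
  have hsub : d ⊆ (a ∩ b ∩ e) ∪ d := Finset.subset_union_right
  have hle : (∏ c ∈ (a ∩ b ∩ e) ∪ d, q c) ≤ ∏ c ∈ d, q c := by
    rw [← Finset.prod_sdiff hsub]
    have h1 : ∏ c ∈ ((a ∩ b ∩ e) ∪ d) \ d, q c ≤ 1 := Finset.prod_le_one (fun c _ => hq0 c) (fun c _ => hq1 c)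
    have h2 : 0 ≤ ∏ c ∈ d, q c := Finset.prod_nonneg fun c _ => hq0 c
    nlinarith
  have hX : 0 ≤ (∏ c ∈ a ∪ (b ∪ d), q c) * (∏ c ∈ a ∪ (b ∪ (e ∪ d)), q c) * (∏ c ∈ (a ∩ b) ∪ (e ∪ d), q c) :=
    mul_nonneg (mul_nonneg (Finset.prod_nonneg fun c _ => hq0 c) (Finset.prod_nonneg fun c _ => hq0 c))
      (Finset.prod_nonneg fun c _ => hq0 c)
  rw [L, R]
  exact mul_le_mul_of_nonneg_left hle hX

/-- **Event form** under `prodBernoulli p`: `W(D+i)W(D+j)W(D+l)W(D+i+j+l) ≤ W(D)W(D+i+j)W(D+i+l)W(D+j+l)` with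
`W(R) = P(no A_x, x ∈ R, is hit)`. [this work; folklore] -/
theorem miss_mobius_three {k : ℕ} (p : ι → unitInterval) (A : Fin k → Finset ι) (D : Finset (Fin k)) (i j l : Fin k) :
    (prodBernoulli p).real {ω : Set ι | ∀ c ∈ (insert i D).biUnion A, c ∉ ω}
        * (prodBernoulli p).real {ω : Set ι | ∀ c ∈ (insert j D).biUnion A, c ∉ ω}
        * (prodBernoulli p).real {ω : Set ι | ∀ c ∈ (insert l D).biUnion A, c ∉ ω}
        * (prodBernoulli p).real {ω : Set ι | ∀ c ∈ (insert i (insert j (insert l D))).biUnion A, c ∉ ω}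
      ≤ (prodBernoulli p).real {ω : Set ι | ∀ c ∈ D.biUnion A, c ∉ ω}
        * (prodBernoulli p).real {ω : Set ι | ∀ c ∈ (insert i (insert j D)).biUnion A, c ∉ ω}
        * (prodBernoulli p).real {ω : Set ι | ∀ c ∈ (insert i (insert l D)).biUnion A, c ∉ ω}
        * (prodBernoulli p).real {ω : Set ι | ∀ c ∈ (insert j (insert l D)).biUnion A, c ∉ ω} := by
  simp only [prodBernoulli_real_forall_notMem]
  exact prod_biUnion_fm3 A (fun c => 1 - (p c : ℝ)) (fun c => sub_nonneg.2 (p c).2.2) (fun c => sub_le_self _ (p c).2.1) D i j l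

end SahiHitting

end Summit.CriticalPhenomena.PercolationContinuityZ3.Theorems
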